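/-
Copyright (c) 2026 the pub-hodgecm-mathlib formalisation cell (harness21).  Prover seat hodgecm-mathlib-K2Liu-p08 (g5), Track B «K2-LIT»,
#184♮ = hLiu418 = `stmt-HodgeConjecture-24832`; #42S organ S1 (local Siegel–Weil spanning), SPLIT HAND: THE SOCKET-SIDE LETTERS OF `hS1sp`
(LEAD F0P6-plan (g14) BATCH #58∕#59 (vii): «`hS1ns`∕`hS1sp` faces of record = K2Liu-p08 (g5)»).
-/
import Summits.HodgeConjecture.HodgeConjecture.Theorems.K2LiuLocalSWSpanningSplitOfMoverMiddleRowsGeneral -- ★ the split face of record over a mover-implementer (p08)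
import Summits.HodgeConjecture.HodgeConjecture.Theorems.K2LiuLocalSWFlipElements                         -- ★ (R-b2-i) `exists_flip_single`
import Literature.NumberTheory.QuadraticForms.QuadraticExtensionPlaces                                   -- ★ `ncard_finitePlacesOver_eq_two_of_isSquare` (O'Meara §65A)
import Literature.NumberTheory.GelbartRogawski1991.CMSplittingCharLocalComponents                        -- ★ `placesOver_eq_of_smul_eq`
import Literature.NumberTheory.GelbartRogawski1991.LocalKudlaSplittingInjectiveTransported               -- ★ `gramR_eq_diagonal`
import Literature.NumberTheory.Automorphic.AddCharConductorExponent                                      -- ★ `exists_normAbs_eq_inv_zpow`, `exists_hasConductorExp`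
import HarnessLib

/-!
# Crux `HLiu418`, #42S organ S1, SPLIT HAND: THE SOCKET-SIDE LETTERS OF THE SPLIT FACE `hS1sp`

Cell `hodgecm-mathlib`, crux item hLiu418 = `stmt-HodgeConjecture-24832`; squad K2 ∕ K2Liu; LEAD F0P6-plan (g14); prover K2Liu-p08 (g5).
THEOREMS ONLY (no `def`, no instance, no notation, no named-fact hypothesis, no `sorry`); lane `--supports stmt-HodgeConjecture-24832 --as helper`.

WHY.  The `hS1sp` slot of the #42S END head (★ `K2LiuStandardSectionSpanBySWGeneratorsEnd(Guarded).standardSectionSpanBySWGenerators_of_S1_S5(_guarded)`,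
binder ll. 79–92) hands the split face ONLY the place `v` and the letter `¬¬ IsSquare (ι_v θ)` (`θ = cmQuadraticGenerator L`).  The split face of record
(★ `K2LiuLocalSWSpanningSplitOfMoverMiddleRowsGeneral.localDegPS_le_localSWImage_record_of_moverMiddleRows_general`, and its sisters ★ p862266 ∕ ★ p862031)
is stated with the by-value letters `(w₀, hw₀)` (a place above `v` MOVED by complex conjugation), `hπ` (a uniformiser of `L⁺_v`), `hdn` (`|δ²|_v = q_v^{−vd}`),
`hm` (a conductor exponent of `ψ_v`) and the partial flip `(i, w₁, hw₁)`.  THIS FILE discharges every one of them from the socket's data, so that the closing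
file `K2LiuLocalSWSpanningSplitFace` (once the middle row `hmid` is paid by the (M2a) chain) is one `obtain` per letter:
* §1 **`exists_placesOver_smul_ne_of_isSquare`** — if `θ` is a square in `L⁺_v` then some (indeed every) `w ∣ v` satisfies `c • w ≠ w`: `θ = α²` with `α`
  purely imaginary (★ `cmQuadraticGenerator_spec`), so `α ∉ L⁺` and O'Meara §65A (★ `QuadraticExtension.ncard_finitePlacesOver_eq_two_of_isSquare`) gives TWO
  places above `v`, while at a place fixed by `c` there is only one (★ `placesOver_eq_of_smul_eq`); the converse is ★ `isSquare_cmQuadraticGenerator_of_smul_ne`,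
  recorded as the dictionary `isSquare_cmQuadraticGenerator_iff_exists_smul_ne`;
* §2 the three valuation letters: `exists_uniformizer` (Mathlib `valuation_exists_uniformizer` + `valuedAdicCompletion_eq_valuation'`), `exists_normAbs_imagUnitSq_eq`
  (★ `exists_normAbs_eq_inv_zpow`, `δ ≠ 0`), `exists_hasConductorExp_adeleAddCharAt` (★ `AddChar.IsContinuousNontrivial.exists_hasConductorExp`);
* §3 `exists_flip_single_hermD` — the partial flip `w₁ ∈ U(𝕍)(L⁺_v)` of the line `i`, `adapt (matA w₁) = [[1 − E_ii, E_ii], [E_ii, 1 − E_ii]]`, for the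
  DIAGONAL Gram matrix `gramR L e dV hdV dW hdW` (★ `exists_flip_single` + ★ `gramR_eq_diagonal`).
References: [Omeara1963] §65A; [CasselsFrohlichANT1967] Ch. II §10, Ch. VII Prop. 1.2 (ii); [WeilBNT1967] Ch. IV §2 Cor. 1 of Th. 3; [Kudla1994] §3;
[HarrisKudlaSweet1996] §1 (1.15).
HONEST LABEL.  Count-neutral helper: `HC_CM` is proved only modulo the 7 printed citations (2 remaining named inputs: hLiu418 = `stmt-HodgeConjecture-24832`,
h413 = `stmt-HodgeConjecture-24833`) until rung 0 closes.  NOT here: the middle row `hmid` ((M2a) chain (C2c)∕(C3), K2Liu-p01 (g10); split reading K2Liu-p08), the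
closing file, the #42S tie.

## References
* [Omeara1963] O. T. O'Meara, *Introduction to quadratic forms*, Grundlehren 117 (1963), §65A.
* [CasselsFrohlichANT1967] J. W. S. Cassels, A. Fröhlich (eds.), *Algebraic Number Theory* (1967), Ch. II §10; Ch. VII Prop. 1.2 (ii).
* [WeilBNT1967] A. Weil, *Basic Number Theory* (1967), Ch. IV §2.
* [Kudla1994] S. S. Kudla, Israel J. Math. 87 (1994), §3.
* [HarrisKudlaSweet1996] M. Harris, S. Kudla, W. J. Sweet, J. Amer. Math. Soc. 9 (1996), §1 (1.15).
-/

set_option autoImplicit false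
set_option linter.dupNamespace false -- the mandated namespace repeats `HodgeConjecture.HodgeConjecture`

noncomputable section

open scoped Matrix NNReal
open NumberField IsDedekindDomain Matrix
open Literature.NumberTheory.Automorphic Literature.NumberTheory.Automorphic.UnitaryGroup
open Literature.NumberTheory.GaloisRepresentations Literature.NumberTheory.GaloisRepresentations.IsNonarchimedeanLocalField
open Literature.NumberTheory.GelbartRogawski1991 Literature.NumberTheory.GelbartRogawski1991.GRConstruction Literature.NumberTheory.GelbartRogawski1991.UnitaryDualPair
open Literature.NumberTheory.GelbartRogawski1991.UnitaryDualPair.LocalSplitting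
open Literature.NumberTheory.GelbartRogawski1991.AdaptedBlocks
open Summit.HodgeConjecture.HodgeConjecture.Cruxes.HLiu418.K2LiuLocalSWFlipElements (exists_flip_single)

namespace Summit.HodgeConjecture.HodgeConjecture.Cruxes.HLiu418.K2LiuLocalSWSpanningSplitFaceLetters

variable (L : Type) [Field L] [NumberField L] [IsCMField L] (v : HeightOneSpectrum (𝓞 (Fp L)))

/-! ## §1 A square `θ` in `L⁺_v` moves every place above `v` -/

/-- `α ∉ L⁺` for the purely imaginary square root `α` of `θ` (`c α = −α ≠ α` since `α ≠ 0`, while `c` fixes `L⁺`). [folklore] -/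
theorem algebraMap_ne_of_complexConj_eq_neg {α : L} (hα0 : α ≠ 0) (hαc : IsCMField.complexConj L α = -α) (r : Fp L) :
    algebraMap (Fp L) L r ≠ α := by
  intro h
  have hfix : IsCMField.complexConj L α = α := by rw [← h]; exact AlgEquiv.commutes _ r
  rw [hαc] at hfix
  -- `-α = α` forces `α = 0` in characteristic zero
  have h2 : (2 : L) * α = 0 := by linear_combination -hfix
  exact hα0 ((mul_eq_zero.1 h2).resolve_left two_ne_zero)

/-- **A SQUARE `θ` IN `L⁺_v` SPLITS `v`**: if `ι_v θ` is a square in `L⁺_v` (`θ = cmQuadraticGenerator L`, `L = L⁺(√θ)`), then there is a place `w₀ ∣ v` of `L`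
with `c • w₀ ≠ w₀` — O'Meara §65A gives two places above `v` (★ `QuadraticExtension.ncard_finitePlacesOver_eq_two_of_isSquare`), and at a place fixed by `c`
there is only one (★ `placesOver_eq_of_smul_eq`). [cite: Omeara1963, §65A] [cite: CasselsFrohlichANT1967, Ch. VII Prop. 1.2 (ii)] -/
theorem exists_placesOver_smul_ne_of_isSquare
    (hsq : IsSquare (algebraMap (Fp L) (v.adicCompletion (Fp L)) (cmQuadraticGenerator L : Fp L))) :
    ∃ w₀ : PlacesOver L v, IsCMField.complexConj L • w₀.1 ≠ w₀.1 := by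
  haveI : Algebra.IsQuadraticExtension (Fp L) L := IsCMField.isQuadraticExtension L
  obtain ⟨α, hα0, hαc, hα⟩ := cmQuadraticGenerator_spec L
  have h2 := Literature.NumberTheory.QuadraticForms.QuadraticExtension.ncard_finitePlacesOver_eq_two_of_isSquare hα
    (algebraMap_ne_of_complexConj_eq_neg L hα0 hαc) v hsq
  obtain ⟨w₁, w₂, hne, h12⟩ := Set.ncard_eq_two.1 h2
  have hw₁ : w₁ ∈ Literature.NumberTheory.QuadraticForms.finitePlacesOver L v := by rw [h12]; exact Set.mem_insert _ _
  have hw₂ : w₂ ∈ Literature.NumberTheory.QuadraticForms.finitePlacesOver L v := by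
    rw [h12]; exact Set.mem_insert_of_mem _ (Set.mem_singleton _)
  rw [Literature.NumberTheory.QuadraticForms.mem_finitePlacesOver_iff] at hw₁ hw₂
  by_contra hall
  push Not at hall
  -- at a place fixed by `c` the fibre is a singleton
  have heq := placesOver_eq_of_smul_eq L v ⟨w₁, hw₁⟩ (hall ⟨w₁, hw₁⟩) ⟨w₂, hw₂⟩
  exact hne (congrArg Subtype.val heq).symm

/-- … hence EVERY place above `v` is moved (the two places `w`, `c • w` exhaust the fibre). [cite: CasselsFrohlichANT1967, Ch. VII Prop. 1.2 (ii)] -/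
theorem smul_ne_of_isSquare
    (hsq : IsSquare (algebraMap (Fp L) (v.adicCompletion (Fp L)) (cmQuadraticGenerator L : Fp L))) (w : PlacesOver L v) :
    IsCMField.complexConj L • w.1 ≠ w.1 := by
  intro hw
  obtain ⟨w₀, hw₀⟩ := exists_placesOver_smul_ne_of_isSquare L v hsq
  have heq := placesOver_eq_of_smul_eq L v w hw w₀
  rw [heq] at hw₀
  exact hw₀ hw

/-- **THE DICTIONARY**: `ι_v θ` is a square in `L⁺_v` iff `v` splits in `L` (some `w ∣ v` with `c • w ≠ w`) — §1 with the converse ★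
`isSquare_cmQuadraticGenerator_of_smul_ne`.  The #42S END head dispatches on the left side, the S1 faces of record are keyed to the right side.
[cite: Omeara1963, §65A] [cite: CasselsFrohlichANT1967, Ch. VII §4.3] -/
theorem isSquare_cmQuadraticGenerator_iff_exists_smul_ne :
    IsSquare (algebraMap (Fp L) (v.adicCompletion (Fp L)) (cmQuadraticGenerator L : Fp L)) ↔
      ∃ w₀ : PlacesOver L v, IsCMField.complexConj L • w₀.1 ≠ w₀.1 :=
  ⟨exists_placesOver_smul_ne_of_isSquare L v, fun ⟨w₀, hw₀⟩ => isSquare_cmQuadraticGenerator_of_smul_ne L v w₀ hw₀⟩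

/-- the socket's double negation removed: `¬¬ IsSquare (ι_v θ) → ∃ w₀ ∣ v, c • w₀ ≠ w₀`. [cite: Omeara1963, §65A] -/
theorem exists_placesOver_smul_ne_of_not_not_isSquare
    (hsq : ¬ (¬ IsSquare (algebraMap (Fp L) (v.adicCompletion (Fp L)) (cmQuadraticGenerator L : Fp L)))) :
    ∃ w₀ : PlacesOver L v, IsCMField.complexConj L • w₀.1 ≠ w₀.1 :=
  exists_placesOver_smul_ne_of_isSquare L v (not_not.1 hsq)

/-! ## §2 The valuation letters `hπ`, `hdn`, `hm` -/

omit [IsCMField L] in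
/-- **a uniformiser of `L⁺_v`** inside the completion: `∃ π, v(π) = exp(−1)` (a global uniformiser, Mathlib `valuation_exists_uniformizer`).
[cite: CasselsFrohlichANT1967, Ch. II §10] -/
theorem exists_uniformizer : ∃ π : v.adicCompletion (Fp L), Valued.v π = WithZero.exp (-1 : ℤ) := by
  obtain ⟨π, hπ⟩ := v.valuation_exists_uniformizer (Fp L)
  exact ⟨(π : v.adicCompletion (Fp L)), by rw [HeightOneSpectrum.valuedAdicCompletion_eq_valuation']; exact hπ⟩

/-- **the letter `hdn`**: `|δ²|_v = q_v^{−vd}` for some `vd ∈ ℤ` (`δ² ≠ 0`; ★ `exists_normAbs_eq_inv_zpow`). [cite: WeilBNT1967, Ch. I §4] -/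
theorem exists_normAbs_imagUnitSq_eq :
    ∃ vd : ℤ, normAbs (v.adicCompletion (Fp L)) ((imagUnitSq L : Fp L) : v.adicCompletion (Fp L)) =
      (residueFieldCard (v.adicCompletion (Fp L)) : ℝ≥0)⁻¹ ^ vd := by
  refine exists_normAbs_eq_inv_zpow ?_
  have hδ2 : (imagUnitSq L : Fp L) ≠ 0 := by
    intro h
    have h' : algebraMap (Fp L) L (imagUnitSq L) = 0 := by rw [h, map_zero]
    rw [← imagUnit_mul_self] at h'
    exact mul_ne_zero (imagUnit_ne_zero L) (imagUnit_ne_zero L) h'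
  exact (_root_.map_ne_zero (algebraMap (Fp L) (v.adicCompletion (Fp L)))).2 hδ2

omit [IsCMField L] in
/-- **the letter `hm`**: the local additive character `ψ_v` has a conductor exponent (★ `AddChar.IsContinuousNontrivial.exists_hasConductorExp` at ★
`isContinuousNontrivial_adeleAddCharAt`). [cite: WeilBNT1967, Ch. IV §2, Cor. 1 of Th. 3] -/
theorem exists_hasConductorExp_adeleAddCharAt : ∃ mψ : ℤ, (adeleAddCharAt (Fp L) v).HasConductorExp mψ :=
  (isContinuousNontrivial_adeleAddCharAt (Fp L) v).exists_hasConductorExp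

/-! ## §3 The partial flip of a line of `𝕍 = V ⊕ (−V)` -/

/-- **THE PARTIAL FLIP `w₁` OF THE LINE `i`** in `U(𝕍)(L⁺_v)`, `𝕍 = hermD L e dV hdV dW hdW`: `adapt (matA w₁) = [[1 − E_ii, E_ii], [E_ii, 1 − E_ii]]` — ★ (R-b2-i)
`exists_flip_single` for the diagonal Gram matrix `gramR L e dV hdV dW hdW` (★ `gramR_eq_diagonal`).  This is the `hw₁` letter of the split ∕ inert ∕ ramified
faces of record. [cite: Kudla1994, §3] [cite: HarrisKudlaSweet1996, §1 (1.15)] -/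
theorem exists_flip_single_hermD {N M n : ℕ} (e : Fin N × Fin M ≃ Fin n)
    (dV : Fin N → L) (hdV : ∀ i, IsCMField.complexConj L (dV i) = dV i)
    (dW : Fin M → L) (hdW : ∀ i, IsCMField.complexConj L (dW i) = dW i) (i : Fin n) :
    ∃ w₁ : UnitaryGroup.localPi L (IsCMField.complexConj L) (n + n) (hermD L e dV hdV dW hdW) v,
      adapt (matA (Fp L) L (IsCMField.complexConj L) v n w₁) =
        Matrix.fromBlocks (1 - Matrix.single i i 1) (Matrix.single i i 1) (Matrix.single i i 1) (1 - Matrix.single i i 1) :=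
  exists_flip_single (Fp L) L (IsCMField.complexConj L) v n (hermD_eq_map_gramD L e dV hdV dW hdW) _ (gramR_eq_diagonal L e dV hdV dW hdW) i

/-! ## §4 All letters at once -/

/-- **THE SOCKET-SIDE LETTERS OF `hS1sp`, BUNDLED**: from `¬¬ IsSquare (ι_v θ)` alone — a moved place `w₀ ∣ v`, a uniformiser `π`, the exponent `vd` of `|δ²|_v`,
a conductor exponent `mψ` of `ψ_v`, and the partial flip `w₁` of the line `i` of `𝕍`.  The closing file of the split face opens this once and feeds ★
`localDegPS_le_localSWImage_record_of_moverMiddleRows_general` (resp. ★ `…_of_middleRows_general`). [cite: Omeara1963, §65A] [cite: Kudla1994, §3]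
[cite: WeilBNT1967, Ch. IV §2] -/
theorem exists_split_face_letters {N M n : ℕ} (e : Fin N × Fin M ≃ Fin n)
    (dV : Fin N → L) (hdV : ∀ i, IsCMField.complexConj L (dV i) = dV i)
    (dW : Fin M → L) (hdW : ∀ i, IsCMField.complexConj L (dW i) = dW i) (i : Fin n)
    (hsq : ¬ (¬ IsSquare (algebraMap (Fp L) (v.adicCompletion (Fp L)) (cmQuadraticGenerator L : Fp L)))) :
    ∃ (w₀ : PlacesOver L v) (π : v.adicCompletion (Fp L)) (vd mψ : ℤ)
      (w₁ : UnitaryGroup.localPi L (IsCMField.complexConj L) (n + n) (hermD L e dV hdV dW hdW) v),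
      IsCMField.complexConj L • w₀.1 ≠ w₀.1 ∧ Valued.v π = WithZero.exp (-1 : ℤ) ∧
      normAbs (v.adicCompletion (Fp L)) ((imagUnitSq L : Fp L) : v.adicCompletion (Fp L)) = (residueFieldCard (v.adicCompletion (Fp L)) : ℝ≥0)⁻¹ ^ vd ∧
      (adeleAddCharAt (Fp L) v).HasConductorExp mψ ∧
      adapt (matA (Fp L) L (IsCMField.complexConj L) v n w₁) =
        Matrix.fromBlocks (1 - Matrix.single i i 1) (Matrix.single i i 1) (Matrix.single i i 1) (1 - Matrix.single i i 1) := by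
  obtain ⟨w₀, hw₀⟩ := exists_placesOver_smul_ne_of_not_not_isSquare L v hsq
  obtain ⟨π, hπ⟩ := exists_uniformizer L v
  obtain ⟨vd, hdn⟩ := exists_normAbs_imagUnitSq_eq L v
  obtain ⟨mψ, hm⟩ := exists_hasConductorExp_adeleAddCharAt L v
  obtain ⟨w₁, hw₁⟩ := exists_flip_single_hermD L v e dV hdV dW hdW i
  exact ⟨w₀, π, vd, mψ, w₁, hw₀, hπ, hdn, hm, hw₁⟩

end Summit.HodgeConjecture.HodgeConjecture.Cruxes.HLiu418.K2LiuLocalSWSpanningSplitFaceLetters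

end
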